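import Summits.CriticalPhenomena.Ising3DConformalLimit.Theorems.EnergyNotSigmaSquaredRungOneAdjacentMergingDefs
import Literature.Probability.LatticeModels.TwoPointGradientEstimate
import Literature.Probability.LatticeModels.RegularScales
import Literature.Probability.LatticeModels.TwoPointSupNormMonotone
import Literature.Probability.LatticeModels.CriticalTwoPointBounds
import HarnessLib

/-!
# One-sided P2 regularity of the critical two-point function of `ℤ³` from a doubling window

Stub `stub_windowRegular` of the line `dominant-shell-concentration` for the crux `RungOneAdjacentMerging`
(item stmt-CriticalPhenomena-11262, route `EnergyNotSigmaSquared`): the statement `WindowRegular` of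
`Theorems/EnergyNotSigmaSquaredRungOneAdjacentMergingDefs.lean`.

**What is proved.** Let `G = ⟨σ₀σ_x⟩⁺_{β_c(3)}` on `ℤ³` (`Gc`, `= ⟨σ₀σ_x⟩^f_{β_c(3)}` by
`twoPointPlus_criticalBeta_eq_twoPointFree_holds`) and `g(m) = G(m e₁)` (`axisG`). For every `A ≥ 1`
there is `C = 48 A` such that for every dyadic scale `ℓ ≥ 4` with the doubling window
`g(2^{ℓ-4}) ≤ A g(2^{ℓ+4})` (`HasWindow A ℓ`), every `v` with `2^{ℓ-2} ≤ ‖v‖_∞ ≤ 2^{ℓ+1}` and every `w`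
with `16 ‖w‖_∞ ≤ 2^ℓ`, `G(v - w) ≤ (1 + C ‖w‖_∞ / 2^ℓ) G(v)`.

**Proof** (the `d = 3` re-run of the P2 part of Aizenman–Duminil-Copin 2021, Prop. 5.9 / Def. 5.11 and
proof of Thm 5.12; the tree's `RegularScales.lean`, Part D, is the `d = 4` instance and is followed
line by line). Write `n = 2^{ℓ-4}`, so `4n ≤ ‖v‖_∞ ≤ 32 n`, `‖w‖_∞ ≤ n`, and the window reads
`S(n e₁) ≤ A S(256 n e₁)` for `S = ⟨σ₀σ_x⟩^f_{β_c}`.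
* Single steps (`window_step_bound`): for `‖z‖_∞ ≥ 3n` and every direction `i`,
  `|S(z + eᵢ) - S(z)| ≤ S(n eᵢ)/n`. Along a coordinate `zᵢ ≥ 2n - 1` this is the Duminil-Copin–Panis
  gradient estimate `twoPointFree_gradient_estimate` (with `j = n`, denominator `zᵢ - n + 1 ≥ n`; at
  `β_c(3)` the spontaneous magnetisation vanishes, `spontaneousMagnetization_criticalBeta_eq_zero_holds`)
  together with the axis Messager–Miracle-Solé inequality (`window_dcp_step`); along a small coordinate
  the step is squeezed between two steps along a dominant coordinate `i₀` by the diagonal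
  Messager–Miracle-Solé inequality and a reflection ("Messager–Miracle-Solé applied twice",
  `window_two_sided_step`); negative coordinates are handled by reflections.
* The path lemma `abs_sub_le_mul_l1Dist_of_steps` along an `ℓ¹`-monotone path from `v` to `v - w`
  (`≤ 3‖w‖_∞` unit steps, coordinate hull inside `{‖z‖_∞ ≥ 3n}`) gives
  `|S(v) - S(v - w)| ≤ 3 ‖w‖_∞ S(n e₁)/n` (`window_path_bound`).
* Finally `S(n e₁) ≤ A S(256 n e₁) ≤ A S(v)` by the window and the diagonal-axis MMS bound
  `twoPointFree_single_le_of_mul_le` (`3 ‖v‖_∞ ≤ 96 n ≤ 256 n`), whence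
  `S(v - w) ≤ S(v) + 3A ‖w‖_∞ S(v)/n = (1 + 48 A ‖w‖_∞/2^ℓ) S(v)`.

Sources: M. Aizenman, H. Duminil-Copin, Ann. of Math. 194 (2021), arXiv:1912.07973, Prop. 5.9 and its
proof (p. 19–20), Def. 5.11 (P2), proof of Thm 5.12 [AizenmanDuminilCopinAnnals2021]; H. Duminil-Copin,
R. Panis, CMP 406 (2025), arXiv:2404.05700, eq. (1.11) [DuminilCopinPanis2025LowerBounds];
Messager–Miracle-Solé 1977 [MessagerMiracleSoleJSP1977].

Design: the step lemmas are stated for general `d`, `β ≥ 0` with `m*(β) = 0` and a scale `n ≥ 1`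
(thresholds `2n - 1` for a large coordinate, `3n` for the hull), so that the smallest scale `ℓ = 4`
(`n = 1`) is covered; only the final assembly is specific to `d = 3`, `β = β_c(3)`. No new definitions,
no named facts.
-/

noncomputable section

open MeasureTheory Filter Finset
open scoped BigOperators ENNReal symmDiff
open Literature.Probability.LatticeModels

namespace Summit.CriticalPhenomena.Ising3DConformalLimit.RungOneAdjacentMergingDominantShell

/-! ### Single steps of the free two-point function above a scale `n` (general `d`, `m*(β) = 0`) -/

section Steps

variable {d : ℕ} {β : ℝ}

/-- **One gradient step along a large coordinate** (Duminil-Copin–Panis form of ADC Prop. 5.9,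
`twoPointFree_gradient_estimate` with `j = n`): for `m*(β) = 0`, `n ≥ 1` and `wᵢ ≥ 2n - 1`,
`0 ≤ S(w) - S(w + eᵢ) ≤ S(n eᵢ)/n` (the denominator `wᵢ - n + 1` is at least `n`; the sign is the axis
Messager–Miracle-Solé inequality). [cite: DuminilCopinPanis2025LowerBounds, eq. (1.11)] -/
theorem window_dcp_step (hβ : 0 ≤ β) (hm0 : spontaneousMagnetization d β = 0) {n : ℕ} (hn : 1 ≤ n)
    {w : Site d} {i : Fin d} (hwi : 2 * (n : ℤ) ≤ w i + 1) :
    0 ≤ twoPointFree d β w - twoPointFree d β (w + Pi.single i 1) ∧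
      twoPointFree d β w - twoPointFree d β (w + Pi.single i 1) ≤
        twoPointFree d β (Pi.single i (n : ℤ)) / n := by
  constructor
  · have h := messager_miracleSole_free hβ w i (by omega)
    linarith
  · have hdcp := twoPointFree_gradient_estimate hβ hm0 i w n (by omega)
    refine hdcp.trans ?_
    have hden : (n : ℝ) ≤ (w i : ℝ) - n + 1 := by
      have h' : (2 : ℝ) * n ≤ (w i : ℝ) + 1 := by exact_mod_cast hwi
      linarith
    have hn0 : (0 : ℝ) < n := by exact_mod_cast hn
    exact div_le_div_of_nonneg_left (twoPointFree_nonneg_of_nonneg hβ _) hn0 hden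

/-- **Two-sided control of a step in a small coordinate** ("the Messager–Miracle-Solé inequality
applied twice", proof of ADC Prop. 5.9, case `i ≠ 1`): if `0 ≤ wᵢ`, `wᵢ + 1 ≤ w_{i₀}` for another
index `i₀` with `w_{i₀} ≥ 2n` (`n ≥ 1`, `m*(β) = 0`), then
`S(w + e_{i₀}) ≤ S(w + eᵢ) ≤ S(w - e_{i₀})` and `S(w + e_{i₀}) ≤ S(w) ≤ S(w - e_{i₀})`, whence
`|S(w + eᵢ) - S(w)| ≤ S(n e_{i₀})/n` by two gradient steps along `i₀`.
[cite: AizenmanDuminilCopinAnnals2021, arXiv:1912.07973 proof of Proposition 5.9 ("use the Messager-Miracle-Sole inequality applied twice", p. 19)] -/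
theorem window_two_sided_step (hβ : 0 ≤ β) (hm0 : spontaneousMagnetization d β = 0) {n : ℕ}
    (hn : 1 ≤ n) {w : Site d} {i i₀ : Fin d} (hii : i₀ ≠ i) (hwi : 0 ≤ w i) (hwi' : w i + 1 ≤ w i₀)
    (hbig : 2 * (n : ℤ) ≤ w i₀) :
    |twoPointFree d β (w + Pi.single i 1) - twoPointFree d β w| ≤
      twoPointFree d β (Pi.single i₀ (n : ℤ)) / n := by
  set S := twoPointFree d β with hS
  -- a1: `S(w + e_{i₀}) ≤ S(w + eᵢ)` (diagonal MMS at `w + eᵢ`)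
  have a1 : S (w + Pi.single i₀ 1) ≤ S (w + Pi.single i 1) := by
    have h := messager_miracleSole_diag_free hβ (w + Pi.single i 1) hii (by simp [hii]; omega)
    have heq : w + Pi.single i 1 + Pi.single i₀ 1 - Pi.single i 1 = w + Pi.single i₀ 1 := by abel
    rw [heq] at h
    exact h
  -- a2: `S(w + eᵢ) ≤ S(w - e_{i₀})` (reflect the `i`-th coordinate, diagonal MMS)
  have a2 : S (w + Pi.single i 1) ≤ S (w - Pi.single i₀ 1) := by
    set u : Site d := Function.update w i (-w i) - Pi.single i₀ 1 with hu
    have hui : u i = -w i := by simp [hu, hii]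
    have hui₀ : u i₀ = w i₀ - 1 := by simp [hu, hii]
    have h := messager_miracleSole_diag_free hβ u hii (by rw [hui, hui₀]; omega)
    have heq1 : u + Pi.single i₀ 1 - Pi.single i 1 =
        Function.update (w + Pi.single i 1) i (-(w + Pi.single i 1 : Site d) i) := by
      funext j
      simp only [hu, Pi.add_apply, Pi.sub_apply, Site.update_neg_apply]
      by_cases hj : j = i
      · subst hj; simp [Ne.symm hii]; ring
      · by_cases hj' : j = i₀
        · subst hj'; simp [hj]
        · simp [hj, hj']
    have heq2 : u = Function.update (w - Pi.single i₀ 1) i (-(w - Pi.single i₀ 1 : Site d) i) := by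
      funext j
      simp only [hu, Pi.sub_apply, Site.update_neg_apply]
      by_cases hj : j = i
      · subst hj; simp [Ne.symm hii]
      · simp [hj]
    rw [heq1, twoPointFree_reflection hβ, heq2, twoPointFree_reflection hβ] at h
    exact h
  -- a3: axis monotonicity at `w` and `w - e_{i₀}`
  have hw0 : 0 ≤ w i₀ := by omega
  have a3 : S (w + Pi.single i₀ 1) ≤ S w := messager_miracleSole_free hβ w i₀ hw0
  have a3' : S w ≤ S (w - Pi.single i₀ 1) := by
    have h := messager_miracleSole_free hβ (w - Pi.single i₀ 1) i₀ (by simp; omega)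
    rw [sub_add_cancel] at h
    exact h
  -- a4: two gradient steps along `i₀`
  have d1 := (window_dcp_step hβ hm0 hn (w := w) (i := i₀) (by omega)).2
  have d2' := window_dcp_step hβ hm0 hn (w := w - Pi.single i₀ 1) (i := i₀) (by simp; omega)
  rw [sub_add_cancel] at d2'
  have d2 := d2'.2
  rw [abs_le]
  constructor <;> linarith

/-- **The single-step bound at points with a non-negative step coordinate**: for `n ≥ 1`,
`m*(β) = 0`, every `w` with `‖w‖_∞ ≥ 3n - 1` and `wᵢ ≥ 0` satisfies `|S(w + eᵢ) - S(w)| ≤ S(n e_{i₁})/n`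
(any reference direction `i₁`): either `wᵢ ≥ 2n - 1` (one gradient step) or a largest coordinate
`i₀ ≠ i` is available for `window_two_sided_step` (after a reflection making it positive).
[cite: AizenmanDuminilCopinAnnals2021, arXiv:1912.07973 proof of Proposition 5.9 and of Theorem 5.12 (P2)] -/
theorem window_step_bound_of_nonneg (hβ : 0 ≤ β) (hm0 : spontaneousMagnetization d β = 0) {n : ℕ}
    (hn : 1 ≤ n) (i₁ : Fin d) {w : Site d} (hw : 3 * n - 1 ≤ Site.supNorm w) {i : Fin d}
    (hwi : 0 ≤ w i) :
    |twoPointFree d β (w + Pi.single i 1) - twoPointFree d β w| ≤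
      twoPointFree d β (Pi.single i₁ (n : ℤ)) / n := by
  by_cases hlarge : 2 * (n : ℤ) ≤ w i + 1
  · obtain ⟨h0, h1⟩ := window_dcp_step hβ hm0 hn (w := w) (i := i) hlarge
    rw [abs_sub_comm, abs_of_nonneg h0, twoPointFree_single_eq_single hβ i₁ i]
    exact h1
  · push Not at hlarge
    obtain ⟨i₀, hi₀⟩ := Site.exists_natAbs_eq_supNorm ⟨i, Finset.mem_univ _⟩ w
    have hbig : 2 * n ≤ (w i₀).natAbs := by rw [hi₀]; omega
    have hii : i₀ ≠ i := by
      rintro rfl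
      omega
    rw [twoPointFree_single_eq_single hβ i₁ i₀]
    rcases lt_or_gt_of_ne (show w i₀ ≠ 0 by omega) with hneg | hposw
    · -- reflect the `i₀`-th coordinate
      set w' : Site d := Function.update w i₀ (-w i₀) with hw'
      have hw'i₀ : w' i₀ = -w i₀ := by simp [hw']
      have hw'i : w' i = w i := by simp [hw', Ne.symm hii]
      have h := window_two_sided_step hβ hm0 hn (w := w') hii (by rw [hw'i]; exact hwi)
        (by rw [hw'i, hw'i₀]; omega) (by rw [hw'i₀]; omega)
      have heq1 : w' + Pi.single i 1 =
          Function.update (w + Pi.single i 1) i₀ (-(w + Pi.single i 1 : Site d) i₀) := by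
        funext j
        simp only [hw', Pi.add_apply, Site.update_neg_apply]
        by_cases hj : j = i₀
        · subst hj; simp [hii]
        · simp [hj]
      rw [heq1, twoPointFree_reflection hβ, hw', twoPointFree_reflection hβ] at h
      exact h
    · exact window_two_sided_step hβ hm0 hn hii hwi (by omega) (by omega)

/-- **The single-step bound above the scale `3n`** (`n ≥ 1`, `m*(β) = 0`): for every `z` with
`‖z‖_∞ ≥ 3n` and every direction `i`, `|S(z + eᵢ) - S(z)| ≤ S(n e_{i₁})/n` (if `zᵢ < 0`, reflect the
`i`-th coordinate of `z + eᵢ`). [cite: AizenmanDuminilCopinAnnals2021, arXiv:1912.07973 proof of Theorem 5.12 (P2 "by the gradient estimate given by Proposition 5.9", p. 20)] -/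
theorem window_step_bound (hβ : 0 ≤ β) (hm0 : spontaneousMagnetization d β = 0) {n : ℕ} (hn : 1 ≤ n)
    (i₁ : Fin d) {z : Site d} (hz : 3 * n ≤ Site.supNorm z) (i : Fin d) :
    |twoPointFree d β (z + Pi.single i 1) - twoPointFree d β z| ≤
      twoPointFree d β (Pi.single i₁ (n : ℤ)) / n := by
  rcases le_or_gt 0 (z i) with hzi | hzi
  · exact window_step_bound_of_nonneg hβ hm0 hn i₁ (by omega) hzi
  · set w : Site d := Function.update (z + Pi.single i 1) i (-(z + Pi.single i 1 : Site d) i) with hw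
    have hwi : 0 ≤ w i := by simp [hw]; omega
    have hnorm : 3 * n - 1 ≤ Site.supNorm w := by
      rw [hw, Site.supNorm_update_neg]
      have h1 := Site.supNorm_le_supNorm_sub_add z (z + Pi.single i 1)
      have h2 : Site.supNorm (z - (z + Pi.single i 1)) ≤ 1 := by
        rw [sub_add_cancel_left, Site.supNorm_neg]
        exact Site.supNorm_single_one_le i
      omega
    have h := window_step_bound_of_nonneg hβ hm0 hn i₁ hnorm hwi
    have heq : w + Pi.single i 1 = Function.update z i (-z i) := by
      funext j
      simp only [hw, Pi.add_apply, Site.update_neg_apply]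
      by_cases hj : j = i
      · subst hj; simp
      · simp [hj]
    rw [heq, twoPointFree_reflection hβ, hw, twoPointFree_reflection hβ, abs_sub_comm] at h
    exact h

/-- **P2 above a scale, path form**: for `n ≥ 1`, `m*(β) = 0`, `‖x‖_∞ ≥ 4n` and `‖x - y‖_∞ ≤ n`,
`|S(x) - S(y)| ≤ (S(n e_{i₁})/n) ‖x - y‖₁` — the path lemma `abs_sub_le_mul_l1Dist_of_steps` with the
single-step bound `window_step_bound` on the coordinate hull of `x, y`, which lies in `{‖z‖_∞ ≥ 3n}`.
[cite: AizenmanDuminilCopinAnnals2021, arXiv:1912.07973 proof of Theorem 5.12 (P2, p. 20)] -/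
theorem window_path_bound (hβ : 0 ≤ β) (hm0 : spontaneousMagnetization d β = 0) {n : ℕ} (hn : 1 ≤ n)
    (i₁ : Fin d) {x y : Site d} (hx : 4 * n ≤ Site.supNorm x) (hxy : Site.supNorm (x - y) ≤ n) :
    |twoPointFree d β x - twoPointFree d β y| ≤
      twoPointFree d β (Pi.single i₁ (n : ℤ)) / n * Site.l1Dist x y := by
  have hstep : ∀ z ∈ {z : Site d | 3 * n ≤ Site.supNorm z}, ∀ i : Fin d,
      |twoPointFree d β (z + Pi.single i 1) - twoPointFree d β z| ≤
        twoPointFree d β (Pi.single i₁ (n : ℤ)) / n := fun z hz i =>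
    window_step_bound hβ hm0 hn i₁ hz i
  have hhull : ∀ z, Site.InHull x y z → z ∈ {z : Site d | 3 * n ≤ Site.supNorm z} := by
    intro z hz
    have h1 := Site.supNorm_sub_le_of_inHull hz
    have h2 := Site.supNorm_le_supNorm_sub_add x z
    rw [Site.supNorm_sub_comm x z] at h2
    show 3 * n ≤ Site.supNorm z
    omega
  exact abs_sub_le_mul_l1Dist_of_steps hstep (Site.l1Dist x y) x y rfl hhull

end Steps

/-! ### The stub -/

/-- STUB 4 — **one-sided P2 from a doubling window** (the `d = 3` re-run of the P2 part of
Aizenman–Duminil-Copin 2021, Prop. 5.9 / Def. 5.11; the tree's `RegularScales` Part D `p2_of_growth` is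
the `d = 4` instance): for `A ≥ 1` there is `C` (`= 48A`) such that if `g(2^{ℓ-4}) ≤ A g(2^{ℓ+4})`
(`ℓ ≥ 4`) then for `2^{ℓ-2} ≤ ‖v‖_∞ ≤ 2^{ℓ+1}` and `16‖w‖_∞ ≤ 2^ℓ`,
`G(v - w) ≤ (1 + C ‖w‖_∞/2^ℓ) G(v)`, `G = ⟨σ₀σ_x⟩⁺_{β_c(3)}` (sup norms). Route: with `n = 2^{ℓ-4}`,
`|S(v) - S(v-w)| ≤ 3‖w‖_∞ S(n e₁)/n` by `window_path_bound` (`S = ⟨σ₀σ_x⟩^f_{β_c} = G`,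
`twoPointPlus_criticalBeta_eq_twoPointFree_holds`; `m*(β_c(3)) = 0`), and
`S(n e₁) ≤ A S(256 n e₁) ≤ A S(v)` by the window and Messager–Miracle-Solé
(`twoPointFree_single_le_of_mul_le`, `3‖v‖_∞ ≤ 256 n`).
[cite: AizenmanDuminilCopinAnnals2021, arXiv:1912.07973 Proposition 5.9 and Definition 5.11 (P2), pp. 19–20] -/
theorem stub_windowRegular :
    ∀ A : ℝ, 1 ≤ A → ∃ C : ℝ, 0 ≤ C ∧ ∀ ℓ : ℕ, 4 ≤ ℓ → HasWindow A ℓ →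
      ∀ v w : Site 3, (2 : ℝ) ^ (ℓ - 2) ≤ ‖v‖ → ‖v‖ ≤ (2 : ℝ) ^ (ℓ + 1) → 16 * ‖w‖ ≤ (2 : ℝ) ^ ℓ →
        Gc (v - w) ≤ (1 + C * ‖w‖ / 2 ^ ℓ) * Gc v := by
  intro A hA
  refine ⟨48 * A, by positivity, ?_⟩
  intro ℓ hℓ hwin v w hv1 hv2 hw
  obtain ⟨m, rfl⟩ : ∃ m, ℓ = m + 4 := ⟨ℓ - 4, by omega⟩
  -- the scale `n = 2^{ℓ-4} = 2^m`
  obtain ⟨n, hn⟩ : ∃ n : ℕ, 2 ^ m = n := ⟨_, rfl⟩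
  have hn1 : 1 ≤ n := hn ▸ Nat.one_le_two_pow
  have hnR : (2 : ℝ) ^ m = n := by rw [← hn]; push_cast; ring
  -- the model at `β_c(3)`: free = plus, `m* = 0`
  have hβ : 0 ≤ criticalBeta 3 := criticalBeta_nonneg 3
  have hm0 : spontaneousMagnetization 3 (criticalBeta 3) = 0 :=
    spontaneousMagnetization_criticalBeta_eq_zero_holds (d := 3) (by norm_num)
  set S : Site 3 → ℝ := twoPointFree 3 (criticalBeta 3) with hS
  have hGS : (Gc : Site 3 → ℝ) = S :=
    funext fun x => twoPointPlus_criticalBeta_eq_twoPointFree_holds (d := 3) (by norm_num) x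
  -- norms as integer sup norms, powers of two as multiples of `n`
  rw [Site.norm_eq_supNorm] at hv1 hv2 hw ⊢
  have h2a : (2 : ℝ) ^ (m + 4 - 2) = 4 * n := by
    rw [show m + 4 - 2 = m + 2 from by omega, pow_add, hnR]; ring
  have h2b : (2 : ℝ) ^ (m + 4 + 1) = 32 * n := by rw [pow_add, pow_add, hnR]; ring
  have h2c : (2 : ℝ) ^ (m + 4) = 16 * n := by rw [pow_add, hnR]; ring
  rw [h2a] at hv1
  rw [h2b] at hv2
  rw [h2c] at hw ⊢
  have hv1' : 4 * n ≤ Site.supNorm v := by exact_mod_cast hv1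
  have hv2' : Site.supNorm v ≤ 32 * n := by exact_mod_cast hv2
  have hw' : Site.supNorm w ≤ n := by
    have h' : (Site.supNorm w : ℝ) ≤ n := by linarith
    exact_mod_cast h'
  -- the window in terms of `S`
  have hwin' : S (Pi.single 0 (n : ℤ)) ≤ A * S (Pi.single 0 ((256 * n : ℕ) : ℤ)) := by
    have h := hwin
    unfold HasWindow axisG at h
    rw [hGS, show m + 4 - 4 = m from by omega,
      show (2 : ℕ) ^ (m + 4 + 4) = 256 * n from by rw [← hn]; ring, hn] at h
    exact h
  -- `S(256 n e₁) ≤ S(v)` (Messager–Miracle-Solé, `3 ‖v‖_∞ ≤ 256 n`)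
  have href : S (Pi.single 0 ((256 * n : ℕ) : ℤ)) ≤ S v :=
    twoPointFree_single_le_of_mul_le hβ (by norm_num : 1 ≤ 3) (by omega)
  -- the path bound from `v` to `v - w`
  have hpath : |S v - S (v - w)| ≤ S (Pi.single 0 (n : ℤ)) / n * Site.l1Dist v (v - w) :=
    window_path_bound hβ hm0 hn1 0 hv1' (by rw [sub_sub_cancel]; exact hw')
  have hl1 : (Site.l1Dist v (v - w) : ℝ) ≤ 3 * Site.supNorm w := by
    have h' := Site.l1Dist_le_mul_supNorm v (v - w)
    rw [sub_sub_cancel] at h'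
    exact_mod_cast h'
  -- combine
  rw [hGS]
  have hSv : 0 ≤ S v := twoPointFree_nonneg_of_nonneg hβ v
  have hn0 : (0 : ℝ) < n := by exact_mod_cast hn1
  have hsw0 : (0 : ℝ) ≤ Site.supNorm w := Nat.cast_nonneg _
  have hκ0 : 0 ≤ S (Pi.single 0 (n : ℤ)) / n :=
    div_nonneg (twoPointFree_nonneg_of_nonneg hβ _) hn0.le
  have key : S (v - w) ≤ S v + S (Pi.single 0 (n : ℤ)) / n * (3 * Site.supNorm w) := by
    have h1 := (abs_sub_le_iff.1 hpath).2
    have h2 := mul_le_mul_of_nonneg_left hl1 hκ0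
    linarith
  have hratio : S (Pi.single 0 (n : ℤ)) / n ≤ A * S v / n :=
    div_le_div_of_nonneg_right (hwin'.trans (mul_le_mul_of_nonneg_left href (by linarith))) hn0.le
  calc S (v - w) ≤ S v + S (Pi.single 0 (n : ℤ)) / n * (3 * Site.supNorm w) := key
    _ ≤ S v + A * S v / n * (3 * Site.supNorm w) := by gcongr
    _ = (1 + 48 * A * Site.supNorm w / (16 * n)) * S v := by
        field_simp
        ring

end Summit.CriticalPhenomena.Ising3DConformalLimit.RungOneAdjacentMergingDominantShell

end
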